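import Summits.HubbardSuperconductivity.HubbardSuperconductivity.Theses.AposterioriCapRg
import Literature.MathematicalPhysics.QuantumLattice.HubbardTorusFlux
import Summits.HubbardSuperconductivity.HubbardSuperconductivity.Theorems.BalabanIRBirEveryGroundStateSchur

/-!
# Sketch — crux-ideate stmt-HubbardSuperconductivity-1315 (`AposterioriCapRg.SsbToEvenTorusLro`), ideator 3, round 1

First lemmas of the two idea cards, typed over existing declarations (no proofs claimed here).

* Card `gentle-repulsion-gap`: the transfer `GentleRepulsionGap` (C⁺) and its one-line variational
  consequence `lroFloor_of_gentleGap` (every sector ground state has `d`-wave pair order ≥ `a`).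
* Card `flux-convexity-kills-windings`: the abstract flux sandwich `fluxSandwich_current_eq_zero` /
  `fluxSandwich_gap_of_current` for a family `H(θ) = H₀ + sin θ • A + (1 - cos θ) • B` preserving a sector,
  and its Hubbard instance over `hubbardTorusFlux` / `seamTwist`.
-/

noncomputable section

namespace Summit.HubbardSuperconductivity.HubbardSuperconductivity.Cruxes.SsbToEvenTorusLro.Sketch

open Literature.MathematicalPhysics.QuantumLattice Literature.Probability.LatticeModels
open Filter Set
open scoped Matrix ComplexOrder
open _root_.Topology
open Summit.HubbardSuperconductivity.HubbardSuperconductivity.Theses.AposterioriCapRg (SsbToEvenTorusLro)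

/-! ## Card 1: gentle (O(1)-normalised) pair repulsion -/

/-- The `d`-wave pair-order DENSITY operator `q̂_L := L⁻⁴ Pᴴ P`, `P = pairField dWaveFormFactor L`
(operator norm `O(1)`, uniformly in `L`). -/
def pairOrderDensityOp (L : ℕ) [NeZero L] :
    Matrix (Finset (Orb (FermionTorus 2 L))) (Finset (Orb (FermionTorus 2 L))) ℂ :=
  ((1 : ℂ) / ((L : ℂ) ^ 4)) • ((pairField dWaveFormFactor L)ᴴ * pairField dWaveFormFactor L)

/-- The gently repelled canonical Hubbard torus `H_L + κ q̂_L` (number- and `S^z`-conserving). -/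
def gentlyRepelled (L : ℕ) [NeZero L] (U κ : ℝ) :
    Matrix (Finset (Orb (FermionTorus 2 L))) (Finset (Orb (FermionTorus 2 L))) ℂ :=
  hubbardTorus 2 L 1 U + (κ : ℂ) • pairOrderDensityOp L

/-- The Statement's particle number at side `L` and doping `δ`. -/
def statN (δ : ℝ) (L : ℕ) : ℕ := 2 * ⌊(1 - δ) * (L : ℝ) ^ 2 / 2⌋₊

/-- GENTLE-REPULSION GAP at `(U, δ)`: an `O(1)` pair-order penalty raises the `(N_L, S^z = 0)`-sector
ground energy by an `L`-independent amount `κ a` along even sides. -/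
def GentleGapAt (U δ : ℝ) : Prop :=
  ∃ κ a : ℝ, 0 < κ ∧ 0 < a ∧ ∃ k₀ : ℕ, ∀ k : ℕ, k₀ ≤ k → ∀ [NeZero (2 * k)],
    (hubbardTorus 2 (2 * k) 1 U).minEnergyOn (szSector (statN δ (2 * k)) 0) + κ * a ≤
      (gentlyRepelled (2 * k) U κ).minEnergyOn (szSector (statN δ (2 * k)) 0)

/-- TRANSFER `C⁺` (card `gentle-repulsion-gap`): the crux with its conclusion replaced by the
gentle-repulsion gap. `C⁺ → SsbToEvenTorusLro` by `lroFloor_of_gentleGap` and the item's bookkeeping. -/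
def GentleRepulsionGap : Prop :=
  ∀ (U δ μ : ℝ), 0 < U → δ ∈ Set.Ioo (0:ℝ) 1 →
    Filter.Tendsto (fun L : ℕ => ((hubbardTorusWith 2 (L + 1) 1 U μ).groundStateFunctional
      totalNumber).re / ((L + 1 : ℕ) : ℝ) ^ 2) Filter.atTop (nhds (1 - δ)) →
    HasDWaveOrder U μ → GentleGapAt U δ

/-- FIRST LEMMA (card 1; provable now, one variational line): if the gently repelled sector energy
exceeds the source-free one by `κ a`, then EVERY normalised sector ground state `ψ` of the source-free
model has `⟨ψ, Pᴴ P ψ⟩ ≥ a L⁴` — because `ψ` is a trial state for `H + κ q̂`: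
`E₀(H + κ q̂) ≤ ⟨ψ, (H + κ q̂) ψ⟩ = E₀(H) + κ L⁻⁴ ⟨ψ, PᴴP ψ⟩`. -/
def lroFloor_of_gentleGap : Prop :=
  ∀ (L : ℕ) [NeZero L] (U κ a : ℝ) (N : ℕ) (ψ : Fock (Orb (FermionTorus 2 L))),
    0 < κ →
    (hubbardTorus 2 L 1 U).minEnergyOn (szSector N 0) + κ * a ≤
      (gentlyRepelled L U κ).minEnergyOn (szSector N 0) →
    star ψ ⬝ᵥ ψ = 1 → IsGroundStateInSector (hubbardTorus 2 L 1 U) N 0 ψ →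
    a * (L : ℝ) ^ 4 ≤ (star ψ ⬝ᵥ ((pairField dWaveFormFactor L)ᴴ * pairField dWaveFormFactor L) *ᵥ ψ).re

/-- PROOF of the first lemma (kernel-checked): the tree's chord inequality
`chord_div_le_re_expect_of_eigen` with `Y = q̂_L`, then unfold the `L⁻⁴` scaling. -/
theorem lroFloor_of_gentleGap_holds : lroFloor_of_gentleGap := by
  intro L _ U κ a N ψ hκ hgap hψ hgs
  have hψK : ψ ∈ szSector N 0 := hgs.1
  have heig := hgs.2.2
  have hchord := Summit.HubbardSuperconductivity.HubbardSuperconductivity.Theorems.chord_div_le_re_expect_of_eigen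
    (hubbardTorus 2 L 1 U) (pairOrderDensityOp L)
    (szSector N 0) hκ hψK hψ heig
  have hL : (0 : ℝ) < (L : ℝ) := Nat.cast_pos.2 (Nat.pos_of_ne_zero (NeZero.ne L))
  have hL4 : (0 : ℝ) < (L : ℝ) ^ 4 := by positivity
  -- the chord: a ≤ (E(H + κ q̂) - E(H)) / κ ≤ Re⟨ψ, q̂ ψ⟩
  have ha : a ≤ (star ψ ⬝ᵥ pairOrderDensityOp L *ᵥ ψ).re := by
    refine le_trans ?_ hchord
    rw [le_div_iff₀ hκ]
    unfold gentlyRepelled at hgap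
    linarith
  -- unfold q̂ = L⁻⁴ • PᴴP inside the expectation
  have hre : (star ψ ⬝ᵥ pairOrderDensityOp L *ᵥ ψ).re =
      (star ψ ⬝ᵥ ((pairField dWaveFormFactor L)ᴴ * pairField dWaveFormFactor L) *ᵥ ψ).re / (L : ℝ) ^ 4 := by
    unfold pairOrderDensityOp
    rw [Matrix.smul_mulVec, dotProduct_smul, smul_eq_mul]
    have hc : ((1 : ℂ) / ((L : ℂ) ^ 4)) = (((1 : ℝ) / (L : ℝ) ^ 4 : ℝ) : ℂ) := by push_cast; ring
    rw [hc, Complex.re_ofReal_mul]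
    ring
  rw [hre, le_div_iff₀ hL4] at ha
  linarith

/-- MONOTONE VERSION (Leans on the sibling Disproof's `lro_mono`, §10): the least pair order over the
source-free ground space dominates the GREATEST pair order over the ground space of the gently
repelled model, for every `κ > 0` (supergradients of the concave `κ ↦ E₀(H + κ q̂)`). -/
def minLro_ge_maxLro_repelled : Prop :=
  ∀ (L : ℕ) [NeZero L] (U κ : ℝ) (N : ℕ) (ψ φ : Fock (Orb (FermionTorus 2 L))),
    0 < κ → star ψ ⬝ᵥ ψ = 1 → star φ ⬝ᵥ φ = 1 →
    IsGroundStateInSector (hubbardTorus 2 L 1 U) N 0 ψ →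
    IsGroundStateInSector (gentlyRepelled L U κ) N 0 φ →
    (star φ ⬝ᵥ ((pairField dWaveFormFactor L)ᴴ * pairField dWaveFormFactor L) *ᵥ φ).re ≤
      (star ψ ⬝ᵥ ((pairField dWaveFormFactor L)ᴴ * pairField dWaveFormFactor L) *ᵥ ψ).re

/-! ### Card 1, the transport chain (how `HasDWaveOrder` manufactures the gentle gap)

`G_L(h, s; μ') := groundEnergy (K_{μ'} - h (P + Pᴴ) - s q̂_L)` on the whole Fock space (grand-canonical,
sourced, seeded): jointly concave in `(h, s)`, even in `h`. The gentle gap at `h = 0` is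
`Γ_L(0, κ; μ') = G_L(0, -κ; μ') - G_L(0, 0; μ')`. -/

/-- The sourced, gently repelled grand-canonical torus `K_{μ'} - h (P + Pᴴ) + κ q̂_L`
(`= dWaveSourceTorus L U μ' h + κ q̂_L`). -/
def sourcedRepelled (L : ℕ) [NeZero L] (U μ' h κ : ℝ) :
    Matrix (Finset (Orb (FermionTorus 2 L))) (Finset (Orb (FermionTorus 2 L))) ℂ :=
  dWaveSourceTorus L U μ' h + (κ : ℂ) • pairOrderDensityOp L

/-- STEP A (exact, finite `L`; provable now): CHORD AT THE REPELLED SOURCED BASE POINT. For any unit ground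
vector `φ` of `K - hX + κ q̂`, the unrepelled sourced energy is at most `E₀(K - hX + κ q̂) - κ ⟨φ, q̂ φ⟩`
(variational), and `⟨φ, q̂ φ⟩ ≥ (Re⟨φ, P φ⟩ / L²)²` (Cauchy–Schwarz): the sourced gentle gap at `h` is at
least `κ ×` (sourced order density of the repelled model)². -/
def chordAtRepelledBase : Prop :=
  ∀ (L : ℕ) [NeZero L] (U μ' h κ : ℝ) (φ : Fock (Orb (FermionTorus 2 L))),
    0 ≤ κ → star φ ⬝ᵥ φ = 1 →
    sourcedRepelled L U μ' h κ *ᵥ φ = (((sourcedRepelled L U μ' h κ).groundEnergy : ℝ) : ℂ) • φ →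
    (dWaveSourceTorus L U μ' h).groundEnergy +
        κ * ((star φ ⬝ᵥ pairField dWaveFormFactor L *ᵥ φ).re / (L : ℝ) ^ 2) ^ 2 ≤
      (sourcedRepelled L U μ' h κ).groundEnergy

/-- STEP B (exact, finite `L`; provable now): `h`-CONCAVITY TRANSPORT OF AN O(1) ENERGY DIFFERENCE. Both
`h ↦ E₀(K - hX)` and `h ↦ E₀(K - hX + κ q̂)` are concave and even, with supergradients bounded by
`‖P + Pᴴ‖ ≤ 2 c_P L²`; hence the gentle gap at `h = 0` loses at most `2 c_P h L²` against the gentle gap at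
`h` — for ANY schedule `h_L` with `h_L L² → 0` the loss vanishes. (`c` below is any bound `‖P‖ ≤ c L²`.) -/
def hTransport : Prop :=
  ∀ (L : ℕ) [NeZero L] (U μ' h κ c : ℝ), 0 ≤ h → 0 ≤ κ →
    (∀ ψ : Fock (Orb (FermionTorus 2 L)), star ψ ⬝ᵥ ψ = 1 →
      |(star ψ ⬝ᵥ pairField dWaveFormFactor L *ᵥ ψ).re| ≤ c * (L : ℝ) ^ 2) →
    ((sourcedRepelled L U μ' h κ).groundEnergy - (dWaveSourceTorus L U μ' h).groundEnergy)
        - 4 * c * h * (L : ℝ) ^ 2 ≤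
      (sourcedRepelled L U μ' 0 κ).groundEnergy - (dWaveSourceTorus L U μ' 0).groundEnergy

/-- STEP C (provable now from the hypothesis; Griffiths sandwich + `‖κ q̂‖ = O(1)`): KOMA–TASAKI ORDER
SURVIVES GENTLE REPULSION AT EVERY FIXED SOURCE. Along any chemical potentials `μ_L → μ`, for every fixed
`h > 0` and `κ ≥ 0`, eventually in `L` some unit ground vector of `K_{μ_L} - h X + κ q̂_L` has sourced
order density `≥ dWaveOrderParameter U μ - ε`. (Energy densities of the repelled and unrepelled models
agree to `O(L⁻²)`; chord slopes converge; `liminf_L` of the tracial density is monotone in `h`.) -/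
def repelledOrder_of_hasDWaveOrder : Prop :=
  ∀ (U μ : ℝ) (μL : ℕ → ℝ), Filter.Tendsto μL Filter.atTop (nhds μ) → HasDWaveOrder U μ →
    ∀ (h κ ε : ℝ), 0 < h → 0 ≤ κ → 0 < ε → ∃ L₀ : ℕ, ∀ (L : ℕ) [NeZero L], L₀ ≤ L →
      ∃ φ : Fock (Orb (FermionTorus 2 L)), star φ ⬝ᵥ φ = 1 ∧
        sourcedRepelled L U (μL L) h κ *ᵥ φ =
          (((sourcedRepelled L U (μL L) h κ).groundEnergy : ℝ) : ℂ) • φ ∧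
        dWaveOrderParameter U μ - ε ≤ (star φ ⬝ᵥ pairField dWaveFormFactor L *ᵥ φ).re / (L : ℝ) ^ 2

/-- STUB (HULL): the canonical/grand-canonical interface at O(1) resolution. `N_L` sits within `η` of the
lower convex hull of the even-`N` sector-energy staircase of the source-free torus, with supporting slopes
`μ_L → μ` (no phase separation at density `1 - δ`; `μ` is THE chemical potential of that density). Min-type
(lower bounds on all sector minima against one line), degeneracy-blind. The sectors range over the
NONEMPTY ones, `n ≤ L²` (`n` up and `n` down electrons on `L²` orbitals per spin); beyond that `szSector = ⊥`
and `minEnergyOn` is the junk value `sInf ∅`. -/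
def HullSupportAt (U δ μ η : ℝ) : Prop :=
  ∃ μL : ℕ → ℝ, Filter.Tendsto μL Filter.atTop (nhds μ) ∧ ∃ k₀ : ℕ, ∀ k : ℕ, k₀ ≤ k → ∀ [NeZero (2 * k)],
    ∀ n : ℕ, n ≤ (2 * k) ^ 2 →
      (hubbardTorus 2 (2 * k) 1 U).minEnergyOn (szSector (statN δ (2 * k)) 0)
        - μL (2 * k) * (statN δ (2 * k) : ℝ) - η ≤
      (hubbardTorus 2 (2 * k) 1 U).minEnergyOn (szSector (2 * n) 0) - μL (2 * k) * ((2 * n : ℕ) : ℝ)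

/-- STUB (MESO): MESOSCOPIC PERSISTENCE of the repelled sourced order — the only place the source is taken
below "fixed h": at `h_L = L⁻³` (any schedule with `h_L L² → 0` above the tower crossover would do) the
gently repelled sourced model around `μ_L` still has a ground vector with sourced order density `≥ a₀`.
By STEP C this holds at every FIXED `h`; the stub is the extension to `h_L`, an `∃`-over-ground-states,
grand-canonical, SOURCED statement (what a construction with an explicit zero mode outputs), carrying
inside it the texture threshold `κ a₀² <` (cost of depleting the pair modulus). -/
def MesoRepelledOrderAt (U δ μ κ a₀ : ℝ) (μL : ℕ → ℝ) : Prop :=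
  ∃ k₀ : ℕ, ∀ k : ℕ, k₀ ≤ k → ∀ [NeZero (2 * k)],
    ∃ φ : Fock (Orb (FermionTorus 2 (2 * k))), star φ ⬝ᵥ φ = 1 ∧
      sourcedRepelled (2 * k) U (μL (2 * k)) (1 / ((2 * k : ℕ) : ℝ) ^ 3) κ *ᵥ φ =
        (((sourcedRepelled (2 * k) U (μL (2 * k)) (1 / ((2 * k : ℕ) : ℝ) ^ 3) κ).groundEnergy : ℝ) : ℂ) • φ ∧
      a₀ ≤ (star φ ⬝ᵥ pairField dWaveFormFactor (2 * k) *ᵥ φ).re / ((2 * k : ℕ) : ℝ) ^ 2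

/-- The guarded residue of the line (both stubs under the crux's antecedents, so `not_crux_imp_order_io`
armour is inherited): -/
def GentleTransportResidue : Prop :=
  ∀ (U δ μ : ℝ), 0 < U → δ ∈ Set.Ioo (0:ℝ) 1 →
    Filter.Tendsto (fun L : ℕ => ((hubbardTorusWith 2 (L + 1) 1 U μ).groundStateFunctional
      totalNumber).re / ((L + 1 : ℕ) : ℝ) ^ 2) Filter.atTop (nhds (1 - δ)) →
    HasDWaveOrder U μ →
    ∃ κ a₀ η : ℝ, 0 < κ ∧ 0 < a₀ ∧ 0 ≤ η ∧ η ≤ κ * a₀ ^ 2 / 4 ∧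
      ∃ μL : ℕ → ℝ, Filter.Tendsto μL Filter.atTop (nhds μ) ∧
        (∃ k₀ : ℕ, ∀ k : ℕ, k₀ ≤ k → ∀ [NeZero (2 * k)],
          ∀ n : ℕ, n ≤ (2 * k) ^ 2 →
            (hubbardTorus 2 (2 * k) 1 U).minEnergyOn (szSector (statN δ (2 * k)) 0)
              - μL (2 * k) * (statN δ (2 * k) : ℝ) - η ≤
            (hubbardTorus 2 (2 * k) 1 U).minEnergyOn (szSector (2 * n) 0) - μL (2 * k) * ((2 * n : ℕ) : ℝ)) ∧
        MesoRepelledOrderAt U δ μ κ a₀ μL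

/-- COMPOSITION (the skeleton a crux-plan would register; steps A, B, the sector/GC comparison and
`lroFloor_of_gentleGap` are provable now): residue ⇒ transfer ⇒ crux. -/
def composition : Prop := GentleTransportResidue → GentleRepulsionGap

/-- The glue the line needs (statement): `C⁺` implies the crux by name. -/
def transfer_closes : Prop := GentleRepulsionGap → SsbToEvenTorusLro

/-! ## Card 2: flux convexity kills windings -/

section Abstract

variable {n : Type*} [Fintype n] [DecidableEq n]

/-- The seam-gauge flux family `H(θ) = H₀ + sin θ • A + (1 - cos θ) • B` (`A` = seam current,
`B` = seam kinetic term; for `hubbardTorusFlux`, `seamTwist L θ = sin θ • A + (1 - cos θ) • B`). -/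
def fluxFamily (H₀ A B : Matrix n n ℂ) (θ : ℝ) : Matrix n n ℂ :=
  H₀ + (Real.sin θ : ℂ) • A + ((1 - Real.cos θ : ℝ) : ℂ) • B

/-- FIRST LEMMA (card 2, part (i); provable now): FLUX DANSKIN SANDWICH. If `θ = 0` is a local
minimiser of the sector energy of the flux family, then EVERY ground vector of `H₀` in the sector
carries zero (seam) current: `⟨ψ, A ψ⟩ = 0`. Min-type hypothesis, every-ground-state conclusion. -/
def fluxSandwich_current_eq_zero : Prop :=
  ∀ (H₀ A B : Matrix n n ℂ) (K : Submodule ℂ (n → ℂ)) (θ₀ : ℝ) (ψ : n → ℂ),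
    H₀.IsHermitian → A.IsHermitian → B.IsHermitian → 0 < θ₀ →
    (∀ v ∈ K, H₀ *ᵥ v ∈ K ∧ A *ᵥ v ∈ K ∧ B *ᵥ v ∈ K) →
    (∀ θ : ℝ, |θ| ≤ θ₀ → H₀.minEnergyOn K ≤ (fluxFamily H₀ A B θ).minEnergyOn K) →
    ψ ∈ K → star ψ ⬝ᵥ ψ = 1 → (star ψ ⬝ᵥ H₀ *ᵥ ψ).re = H₀.minEnergyOn K →
    (star ψ ⬝ᵥ A *ᵥ ψ).re = 0

/-- FIRST LEMMA (card 2, part (ii); provable now): under QUADRATIC flux convexity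
`E(θ) ≥ E(0) + ρ θ²` on `|θ| ≤ θ₀`, every unit vector of the sector with seam current `j = ⟨φ, A φ⟩`
is excited by at least `j²/(4(‖B‖ + ρ))` once `|j| ≤ 2 θ₀ (‖B‖ + ρ)·(2/π)` — current-carrying states
(windings, helical/FFLO condensates) are GAPPED BY THEIR CURRENT SQUARED. (`b` bounds `|⟨φ, Bφ⟩|`.) -/
def fluxSandwich_gap_of_current : Prop :=
  ∀ (H₀ A B : Matrix n n ℂ) (K : Submodule ℂ (n → ℂ)) (θ₀ ρ b : ℝ) (φ : n → ℂ),
    H₀.IsHermitian → A.IsHermitian → B.IsHermitian → 0 < θ₀ → θ₀ ≤ Real.pi / 2 → 0 ≤ ρ → 0 ≤ b →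
    (∀ v ∈ K, H₀ *ᵥ v ∈ K ∧ A *ᵥ v ∈ K ∧ B *ᵥ v ∈ K) →
    (∀ θ : ℝ, |θ| ≤ θ₀ → H₀.minEnergyOn K + ρ * θ ^ 2 ≤ (fluxFamily H₀ A B θ).minEnergyOn K) →
    φ ∈ K → star φ ⬝ᵥ φ = 1 → |(star φ ⬝ᵥ B *ᵥ φ).re| ≤ b →
    |(star φ ⬝ᵥ A *ᵥ φ).re| ≤ θ₀ * (b + ρ) →
    ((star φ ⬝ᵥ A *ᵥ φ).re) ^ 2 / (4 * (b + ρ) + 1) ≤ (star φ ⬝ᵥ H₀ *ᵥ φ).re - H₀.minEnergyOn K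

end Abstract

/-- The seam current through the cut `{x₁ = L-1} → {x₁ = 0}`:
`J_seam = -i Σ_{y,σ} (c†_{(0,y)σ} c_{(L-1,y)σ} - c†_{(L-1,y)σ} c_{(0,y)σ})`, so that
`seamTwist L θ = sin θ • J_seam + (1 - cos θ) • T_seam`. -/
def seamCurrent (L : ℕ) [NeZero L] :
    Matrix (Finset (Orb (FermionTorus 2 L))) (Finset (Orb (FermionTorus 2 L))) ℂ :=
  ∑ y : ZMod L, ∑ σ : Fin 2,
    ((-Complex.I) • (creation (orb (FermionTorus.ofTorusSite ![0, y]) σ) *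
        annihilation (orb (FermionTorus.ofTorusSite ![-1, y]) σ)) +
     Complex.I • (creation (orb (FermionTorus.ofTorusSite ![-1, y]) σ) *
        annihilation (orb (FermionTorus.ofTorusSite ![0, y]) σ)))

/-- LOCAL FLUX CONVEXITY at `(U, δ)` (the `|θ| ≤ θ₀` germ of route FluxSpectroscopy's `FC_T`;
min-type, degeneracy-blind): eventually along even sides, `fluxEnergy L U δ θ ≥ fluxEnergy L U δ 0 + ρ θ²`
for `|θ| ≤ θ₀`. -/
def LocalFluxConvexityAt (U δ : ℝ) : Prop :=
  ∃ ρ θ₀ : ℝ, 0 < ρ ∧ 0 < θ₀ ∧ ∃ k₀ : ℕ, ∀ k : ℕ, k₀ ≤ k → ∀ [NeZero (2 * k)], ∀ θ : ℝ, |θ| ≤ θ₀ →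
    fluxEnergy (2 * k) U δ 0 + ρ * θ ^ 2 ≤ fluxEnergy (2 * k) U δ θ

/-- The guarded (armoured) stub the line files: flux convexity is claimed only under the crux's own
antecedents, so a refutation must exhibit Koma–Tasaki `d`-wave order at some `U > 0`. -/
def GuardedFluxConvexity : Prop :=
  ∀ (U δ μ : ℝ), 0 < U → δ ∈ Set.Ioo (0:ℝ) 1 →
    Filter.Tendsto (fun L : ℕ => ((hubbardTorusWith 2 (L + 1) 1 U μ).groundStateFunctional
      totalNumber).re / ((L + 1 : ℕ) : ℝ) ^ 2) Filter.atTop (nhds (1 - δ)) →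
    HasDWaveOrder U μ → LocalFluxConvexityAt U δ

/-- Hubbard instance of the sandwich (statement): under local flux convexity, every `(N_L, S^z=0)`
sector ground state of the source-free torus has zero seam current. -/
def everyGS_seamCurrent_eq_zero : Prop :=
  ∀ (U δ : ℝ), LocalFluxConvexityAt U δ → ∃ k₀ : ℕ, ∀ k : ℕ, k₀ ≤ k → ∀ [NeZero (2 * k)],
    ∀ ψ : Fock (Orb (FermionTorus 2 (2 * k))), star ψ ⬝ᵥ ψ = 1 →
      IsGroundStateInSector (hubbardTorus 2 (2 * k) 1 U) (statN δ (2 * k)) 0 ψ →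
      (star ψ ⬝ᵥ seamCurrent (2 * k) *ᵥ ψ).re = 0

end Summit.HubbardSuperconductivity.HubbardSuperconductivity.Cruxes.SsbToEvenTorusLro.Sketch
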